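import Mathlib
import Literature.NumberTheory.LFunctions.Zhang2022.Section15BStep15u035
import Literature.NumberTheory.LFunctions.Zhang2022.Section8Lemma84LBounds
import Literature.NumberTheory.LFunctions.Zhang2022.Section8Lemma84Coeff
import Literature.NumberTheory.LFunctions.Zhang2022.Section7ZetaLowerBound
import HarnessLib

/-!
# Zhang (2022), §15 (15.15): the prefactor `Φ(s) = ζ(1+s+β₁)ζ(1+s+β₂)𝓜₁(d,l;1+s)d^{β₃}/(ζ(1+s)L(1+s,χ))`
# on Landau's contour — the three sup bounds and the continuity on the line `Re s = 1`

Topic `Literature/NumberTheory/LFunctions/Zhang2022` (Landau–Siegel audit tree; verdict-neutral).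
Y. Zhang, *Discrete mean estimates and the Landau–Siegel zero*, arXiv:2211.02515v1 (2022)
[Zhang2022LandauSiegel] — **an unrefereed manuscript under adjudication; nothing here asserts or denies
its Theorems 1–2.** §15 p. 85, tex L4213–L4224: after (15.14) is rewritten (display §15.u036,
`Typed.Section15B.integrandU036`) as
`𝒟₁(d,l) = λ₁(d)(2πi)⁻¹∫_{(1)} ζ(1+s+β₁)ζ(1+s+β₂)𝓜₁(d,l;1+s)ζ(1+s)⁻¹L(1+s,χ)⁻¹P₄^{s+β₃}d^{−s}
ω₁(s+β₃)(s+β₃)⁻¹ds + O(ε)`, the manuscript says (15.15) follows "in a way similar to the proof of Lemma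
8.4", i.e. by moving the line `Re s = 1` to Landau's broken line. The ZHANG-L lane (WP15-PLAN v0.1
§3.2, leaf `Eq15_17`) splits that move into the generic Gaussian-kernel engine
(`GaussKernelContour.norm_lineIntegral_sub_residues_le`, kernel `Y^{s+β}ω₁(s+β)/(s+β)` with `Y = P₄/d`,
`β = β₃`), the pole/residue data (part B, seat zl-w15-p1), and the present file (part A): **the
analytic input about the prefactor**

  `Φ(s) := ζ(1+s+β₁)·ζ(1+s+β₂)·𝓜₁(d,l;1+s) / (ζ(1+s)·L(1+s,χ)) · d^{β₃}`

(written out verbatim in every statement, in the shape of `Eq1515.Phi_eq_of_ne_zero` of the companion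
`Section15BEq1515Poles` with `M = 𝓜₁(d,l;·) = Typed.Section15B.calM1 c′ χ d l`, `cst = d^{β₃}`): the
engine's hypotheses `hΦ₀/hΦ₁/hΦ₂` and the continuity behind `hint`, under Assumption (A), for `D`
large, every `d, l ≥ 1`, with the weight `W(d,l) = ∏_{q∣dl}(1 + c₀q^{−9/10})` of §15.u035 (`c₀ ≥ 0`):

* `phi1515_bounds` — with an exported depth `c₁ ∈ (0, 1/12]` (one third of the constant of
  `Lemma84.exceptional_package`) and absolute `c₀, C ≥ 0`; per `D, χ` it also exports the
  exceptional zero `ρ̃ < 1` with `1 − ρ̃ ≤ c₁/(2𝓛)`, `L(ρ̃,χ) = 0 ≠ L′(ρ̃,χ)`, and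
  `‖L(w,χ)⁻¹‖ ≤ C𝓛(1 + ‖w − ρ̃‖⁻¹)`, `L(w,χ) ≠ 0` (`w ≠ ρ̃`), `‖ζ(w)⁻¹‖ ≤ C𝓛⁹`, `ζ(w) ≠ 0` (`w ≠ 1`) on
  the closed region `Re w ≥ 1 − c₁/𝓛`, `|Im w| ≤ D/2` (for the part-B pole bookkeeping); then:
  (line) `Re s = 1`: `‖Φ(s)‖ ≤ C·W(d,l)` for every `t` (`ζ, ζ⁻¹, L⁻¹` at `σ = 2`; `𝓜₁` by u035;
  `|d^{β₃}| = 1`);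
  (left) `Re s = −c₁/𝓛`, `|Im s| ≤ D/2`: `‖Φ(s)‖ ≤ C𝓛¹³W(d,l)` (Titchmarsh 3.5 / the pole of `ζ` at
  distance `c₁/𝓛`; `‖ζ(1+s)⁻¹‖ ≤ C𝓛⁹` under (A), `ZetaLowerBound.norm_inv_zeta_le_pow_nine`;
  `‖L(1+s,χ)⁻¹‖ ≤ Cℒ(1+|1+s−ρ̃|⁻¹) ≤ C′𝓛²`, `exceptional_package`, the exceptional zero lying within
  `c₁/(2𝓛)` of `1`);
  (horizontal) `−c₁/𝓛 ≤ Re s ≤ 1`, `4 ≤ |Im s| ≤ D/2`: `‖Φ(s)‖ ≤ C𝓛¹³W(d,l)`;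
  so any height `H ∈ [4, D/2]` (e.g. `H = 𝓛²⁰`) and the depth `a = −c₁/𝓛` fit the engine; at all these
  points `ζ(1+s) ≠ 0` and `L(1+s,χ) ≠ 0`.
* `differentiableOn_phi1515_right`, `continuous_phi1515_line` — under the same standing data, `Φ` is
  holomorphic on `Re s > 0` and `t ↦ Φ(1+it)` is continuous (so that
  `GaussKernelContour.integrable_integrand_line` applies at `σ₀ = 1`).

Everything is proved from tree theorems (`ZetaNearOne.*`, `ZetaLowerBound.norm_inv_zeta_le_pow_nine`,
`zeta_ne_zero_wide`, `Lemma84.exceptional_package`, `Lemma84.inv_LFunction_le_right`,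
`Typed.Section15B.step15_u035_holds`, `step15_u034an_holds`); no definitions, no facts. WHAT THIS IS NOT:
the residues of (15.15)/(15.16), the `O(D^{−c})`-type remainder arithmetic, or anything about Landau–
Siegel zeros.

## References

* Y. Zhang, arXiv:2211.02515v1 (2022), §15 (15.15)–(15.16) p. 85 (tex L4213–L4224); §8 proof of
  Lemma 8.4 p. 46. [cite: Zhang2022LandauSiegel, §15 (15.15) p.85]
* E. C. Titchmarsh, *The Theory of the Riemann Zeta-Function* (1986), Thm 3.5, §3.11.
  [cite: Titchmarsh1986, Thm. 3.5]
* H. L. Montgomery, R. C. Vaughan, *Multiplicative Number Theory I* (2007), Thm 11.4 (11.10), §6.2.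
  [cite: MontgomeryVaughan2007, Thm 11.4]
-/

noncomputable section

open Complex Real Filter Topology

namespace Literature.NumberTheory.LFunctions.Zhang2022.Eq1515

open Literature.NumberTheory.LFunctions.Zhang2022
open Literature.NumberTheory.LFunctions.Zhang2022.Skeleton
open Literature.NumberTheory.LFunctions.Zhang2022.Typed.Section15B (calM1)

/-! ## Small inputs: `𝓛`, the shifts, `d^{β₃}`, products of bounds -/

/-- For every `L₀` there is `D₀` with `𝓛 = log D ≥ L₀` for `D ≥ D₀`. [folklore] -/
private theorem exists_nat_ell_ge (L₀ : ℝ) :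
    ∃ D₀ : ℕ, ∀ D : ℕ, D₀ ≤ D → L₀ ≤ ell D := by
  refine ⟨⌈Real.exp L₀⌉₊ + 1, fun D hD => ?_⟩
  have h1 : Real.exp L₀ ≤ D := by
    have : (⌈Real.exp L₀⌉₊ : ℝ) + 1 ≤ D := by exact_mod_cast hD
    linarith [Nat.le_ceil (Real.exp L₀)]
  have hD0 : (0 : ℝ) < D := lt_of_lt_of_le (Real.exp_pos L₀) h1
  unfold ell
  rw [Real.le_log_iff_exp_le hD0]
  exact h1

/-- The shifts are purely imaginary: `Re β_j = 0`. [cite: Zhang2022LandauSiegel, §2 (2.13)] -/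
private theorem betaJ_re' (c' : ℝ) (D j : ℕ) : (betaJ c' D j).re = 0 := by
  unfold betaJ
  split_ifs <;> simp [beta1, beta2, beta3]

/-- `α = π/𝓛⁹` (`log P = 𝓛⁹`). [cite: Zhang2022LandauSiegel, §2 (2.10)] -/
private theorem alpha_eq (D : ℕ) : alpha D = Real.pi / ell D ^ 9 := by
  unfold alpha bigP
  rw [Real.log_exp]

/-- For `𝓛 ≥ 4` and `𝓛 ≥ |c′|`: `‖β_j‖ ≤ 1`. [cite: Zhang2022LandauSiegel, §2 (2.13)] -/
private theorem norm_betaJ_le_one (c' : ℝ) {D : ℕ} (j : ℕ) (hℓ4 : 4 ≤ ell D) (hℓc : |c'| ≤ ell D) :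
    ‖betaJ c' D j‖ ≤ 1 := by
  set ℓ := ell D with hℓ
  have hℓ0 : 0 < ℓ := by linarith
  have hα : alpha D = Real.pi / ℓ ^ 9 := alpha_eq D
  have hα0 : 0 ≤ alpha D := by rw [hα]; positivity
  have hπ : Real.pi ≤ 4 := Real.pi_le_four
  have hℓ9 : (4 : ℝ) ^ 9 ≤ ℓ ^ 9 := pow_le_pow_left₀ (by norm_num) hℓ4 9
  have hα1 : alpha D ≤ 4 / 4 ^ 9 := by
    rw [hα]
    calc Real.pi / ℓ ^ 9 ≤ 4 / ℓ ^ 9 := by gcongr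
      _ ≤ 4 / 4 ^ 9 := by gcongr
  have hcαℓ : |c'| * alpha D * ℓ ≤ 4 / 4 ^ 7 := by
    rw [hα]
    have hℓ7 : (4 : ℝ) ^ 7 ≤ ℓ ^ 7 := pow_le_pow_left₀ (by norm_num) hℓ4 7
    have h1 : |c'| * (Real.pi / ℓ ^ 9) * ℓ = |c'| / ℓ * (Real.pi / ℓ ^ 7) := by
      field_simp
    rw [h1]
    have h2 : |c'| / ℓ ≤ 1 := (div_le_one hℓ0).mpr hℓc
    calc |c'| / ℓ * (Real.pi / ℓ ^ 7) ≤ 1 * (4 / 4 ^ 7) := by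
          gcongr
      _ = 4 / 4 ^ 7 := one_mul _
  have h := Lemma84.norm_betaJ_le c' D j hα0 hℓ0.le
  calc ‖betaJ c' D j‖ ≤ 3 * alpha D * (1 + 5 * |c'| * alpha D * ell D) := h
    _ = 3 * alpha D * (1 + 5 * (|c'| * alpha D * ℓ)) := by rw [hℓ]; ring
    _ ≤ 3 * (4 / 4 ^ 9) * (1 + 5 * (4 / 4 ^ 7)) := by gcongr
    _ ≤ 1 := by norm_num

/-- `‖d^{β}‖ = 1` for `d ≥ 1` and purely imaginary `β`. [folklore] -/
private theorem norm_natCast_cpow_of_re_zero {d : ℕ} (hd : 1 ≤ d) {β : ℂ} (hβ : β.re = 0) :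
    ‖(d : ℂ) ^ β‖ = 1 := by
  rw [Complex.norm_natCast_cpow_of_pos (by omega), hβ, Real.rpow_zero]

/-- The shape of `Φ`: `‖ab·m/(yz)·e‖ ≤ A·B·M·Y·Z` from `‖a‖ ≤ A`, `‖b‖ ≤ B`, `‖m‖ ≤ M`, `‖e‖ = 1`,
`‖y⁻¹‖ ≤ Y`, `‖z⁻¹‖ ≤ Z`. [folklore] -/
private theorem norm_shape_le {a b m e y z : ℂ} {A B M Y Z : ℝ} (ha : ‖a‖ ≤ A) (hb : ‖b‖ ≤ B)
    (hm : ‖m‖ ≤ M) (he : ‖e‖ = 1) (hy : ‖y⁻¹‖ ≤ Y) (hz : ‖z⁻¹‖ ≤ Z) :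
    ‖a * b * m / (y * z) * e‖ ≤ A * B * M * Y * Z := by
  have hA : 0 ≤ A := (norm_nonneg _).trans ha
  have hB : 0 ≤ B := (norm_nonneg _).trans hb
  have hM : 0 ≤ M := (norm_nonneg _).trans hm
  have hY : 0 ≤ Y := (norm_nonneg _).trans hy
  rw [div_eq_mul_inv, mul_inv, norm_mul, norm_mul, norm_mul, norm_mul, norm_mul, he, mul_one]
  have h1 : ‖a‖ * ‖b‖ ≤ A * B := mul_le_mul ha hb (norm_nonneg _) hA
  have h2 : ‖a‖ * ‖b‖ * ‖m‖ ≤ A * B * M := mul_le_mul h1 hm (norm_nonneg _) (by positivity)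
  have h3 : ‖y⁻¹‖ * ‖z⁻¹‖ ≤ Y * Z := mul_le_mul hy hz (norm_nonneg _) hY
  calc ‖a‖ * ‖b‖ * ‖m‖ * (‖y⁻¹‖ * ‖z⁻¹‖) ≤ A * B * M * (Y * Z) :=
        mul_le_mul h2 h3 (by positivity) (by positivity)
    _ = A * B * M * Y * Z := by ring

/-! ## `ζ` next to the line `σ = 1` -/

/-- **`ζ` in the region `Re w ≥ 1 − 𝓛⁻¹`, `Re w ≤ 2`, `|Im w| ≤ 2D`, at distance `≥ δ` from the
pole**: `‖ζ(w)‖ ≤ 16e²𝓛 + M + δ⁻¹` (`M` the rectangle constant of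
`ZetaNearOne.exists_bound_riemannZeta_rect`): for `|Im w| ≥ 3` Titchmarsh's Theorem 3.5 with `A = 2`
at depth `𝓛⁻¹ ≤ 2/log|Im w|`, otherwise the rectangle bound `M + 1/‖w−1‖`.
[cite: Titchmarsh1986, Thm. 3.5] -/
theorem norm_zeta_le_region {w : ℂ} {ℓ M δ : ℝ} {D : ℕ} (hℓ4 : 4 ≤ ℓ)
    (hℓD : (D : ℝ) = Real.exp ℓ) (hM0 : 0 ≤ M)
    (hM : ∀ s : ℂ, 1 / 2 ≤ s.re → s.re ≤ 2 → |s.im| ≤ 3 → s ≠ 1 →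
      ‖riemannZeta s‖ ≤ M + 1 / ‖s - 1‖)
    (hre : 1 - ℓ⁻¹ ≤ w.re) (hre2 : w.re ≤ 2) (himD : |w.im| ≤ 2 * D) (hδ : 0 < δ)
    (hdist : δ ≤ ‖w - 1‖) :
    ‖riemannZeta w‖ ≤ 16 * Real.exp 2 * ℓ + M + δ⁻¹ := by
  have hℓ0 : 0 < ℓ := by linarith
  have hℓinv : ℓ⁻¹ ≤ 1 / 4 := by
    rw [inv_eq_one_div]; exact one_div_le_one_div_of_le (by norm_num) hℓ4
  have hE : 0 ≤ 16 * Real.exp 2 * ℓ := by positivity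
  have hδi : 0 < δ⁻¹ := inv_pos.mpr hδ
  rcases le_or_gt 3 |w.im| with h3 | h3
  · -- logarithmic region
    have hlog0 : 0 < Real.log |w.im| := Real.log_pos (by linarith)
    have hlog : Real.log |w.im| ≤ 2 * ℓ := by
      have hD0 : (0 : ℝ) < D := by rw [hℓD]; exact Real.exp_pos _
      calc Real.log |w.im| ≤ Real.log (2 * D) := Real.log_le_log (by linarith) himD
        _ = Real.log 2 + ℓ := by
            rw [Real.log_mul (by norm_num) hD0.ne', hℓD, Real.log_exp]
        _ ≤ 2 * ℓ := by linarith [Real.log_two_lt_d9]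
    have hdepth : 1 - 2 / Real.log |w.im| ≤ w.re := by
      have : ℓ⁻¹ ≤ 2 / Real.log |w.im| := by
        rw [inv_eq_one_div, div_le_div_iff₀ hℓ0 hlog0]; linarith
      linarith
    have h := ZetaNearOne.norm_riemannZeta_le_exp_mul_log (s := w) (A := 2) (by norm_num) h3
      (by linarith) hdepth
    calc ‖riemannZeta w‖ ≤ 8 * Real.exp 2 * Real.log |w.im| := h
      _ ≤ 8 * Real.exp 2 * (2 * ℓ) := by gcongr
      _ = 16 * Real.exp 2 * ℓ := by ring
      _ ≤ 16 * Real.exp 2 * ℓ + M + δ⁻¹ := by linarith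
  · -- next to the pole
    have hw1 : w ≠ 1 := by
      intro h; rw [h, sub_self, norm_zero] at hdist; linarith
    have h := hM w (by linarith) hre2 h3.le hw1
    have hinv : 1 / ‖w - 1‖ ≤ δ⁻¹ := by
      rw [one_div]; exact inv_anti₀ hδ hdist
    linarith

/-- Bookkeeping: the five factor bounds multiply to `C·𝓛¹³·W`. [folklore] -/
private theorem assemble_le {x Z ℓ A W B E C : ℝ}
    (hx : x ≤ (Z * ℓ) * (Z * ℓ) * (A * W) * (B * ℓ ^ 9) * (E * ℓ ^ 2))
    (hC : Z * Z * A * B * E ≤ C) (hℓ : 0 ≤ ℓ) (hW : 0 ≤ W) : x ≤ C * ℓ ^ 13 * W := by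
  have e : (Z * ℓ) * (Z * ℓ) * (A * W) * (B * ℓ ^ 9) * (E * ℓ ^ 2) =
      (Z * Z * A * B * E) * (ℓ ^ 13 * W) := by ring
  have h0 : 0 ≤ ℓ ^ 13 * W := mul_nonneg (pow_nonneg hℓ 13) hW
  calc x ≤ _ := hx
    _ = (Z * Z * A * B * E) * (ℓ ^ 13 * W) := e
    _ ≤ C * (ℓ ^ 13 * W) := mul_le_mul_of_nonneg_right hC h0
    _ = C * ℓ ^ 13 * W := by ring

/-- Bookkeeping for `L⁻¹` on the left segment: `CL·3𝓛·(1 + 2𝓛/c₁) ≤ 3CL(1+2/c₁)·𝓛²`. [folklore] -/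
private theorem inv_bound_left {n i CL ℓ c₁ : ℝ} (hn : n ≤ CL * (3 * ℓ) * (1 + i))
    (hi : i ≤ 2 * ℓ / c₁) (hCL : 0 ≤ CL) (hℓ1 : 1 ≤ ℓ) :
    n ≤ 3 * CL * (1 + 2 / c₁) * ℓ ^ 2 := by
  have hℓ0 : 0 ≤ ℓ := by linarith
  have hfac : 0 ≤ CL * (3 * ℓ) := by positivity
  have h2 : 1 + 2 * ℓ / c₁ ≤ (1 + 2 / c₁) * ℓ := by
    have e : (1 + 2 / c₁) * ℓ = ℓ + 2 * ℓ / c₁ := by ring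
    rw [e]; linarith
  calc n ≤ CL * (3 * ℓ) * (1 + i) := hn
    _ ≤ CL * (3 * ℓ) * (1 + 2 * ℓ / c₁) := mul_le_mul_of_nonneg_left (by linarith) hfac
    _ ≤ CL * (3 * ℓ) * ((1 + 2 / c₁) * ℓ) := mul_le_mul_of_nonneg_left h2 hfac
    _ = 3 * CL * (1 + 2 / c₁) * ℓ ^ 2 := by ring

/-- Bookkeeping for `L⁻¹` on the horizontal segments (`‖w − ρ̃‖ ≥ 4`, `c₁ ≤ 1/12`). [folklore] -/
private theorem inv_bound_horiz {n i CL ℓ c₁ : ℝ} (hn : n ≤ CL * (3 * ℓ) * (1 + i))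
    (hi : i ≤ 1 / 4) (hCL : 0 ≤ CL) (hℓ1 : 1 ≤ ℓ) (hc₁ : 0 < c₁) (hc₁1 : c₁ ≤ 1 / 12) :
    n ≤ 3 * CL * (1 + 2 / c₁) * ℓ ^ 2 := by
  have hℓ0 : 0 ≤ ℓ := by linarith
  have hfac : 0 ≤ CL * (3 * ℓ) := by positivity
  have h24 : 24 ≤ 2 / c₁ := by
    rw [le_div_iff₀ hc₁]; linarith
  have h2 : (1 : ℝ) + 1 / 4 ≤ (1 + 2 / c₁) * ℓ := by
    have e : (1 + 2 / c₁) * ℓ = ℓ + (2 / c₁) * ℓ := by ring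
    rw [e]; nlinarith
  calc n ≤ CL * (3 * ℓ) * (1 + i) := hn
    _ ≤ CL * (3 * ℓ) * (1 + 1 / 4) := mul_le_mul_of_nonneg_left (by linarith) hfac
    _ ≤ CL * (3 * ℓ) * ((1 + 2 / c₁) * ℓ) := mul_le_mul_of_nonneg_left h2 hfac
    _ = 3 * CL * (1 + 2 / c₁) * ℓ ^ 2 := by ring

/-! ## The bounds package -/

set_option maxHeartbeats 1600000 in -- one long bookkeeping assembly (three contour pieces × five factors)
/-- **The prefactor `Φ` of (15.15) on Landau's contour, under (A)** (§15 p. 85, "in a way similar to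
the proof of Lemma 8.4"). There are absolute constants `c₁ ∈ (0, 1/12]`, `c₀ ≥ 0`, `C ≥ 0` such that
for all large `D`, every real primitive `χ (mod D)` satisfying (A), and all `d, l ≥ 1`, with
`Φ(s) = ζ(1+s+β₁)ζ(1+s+β₂)𝓜₁(d,l;1+s)d^{β₃}/(ζ(1+s)L(1+s,χ))` and `W = ∏_{q∣dl}(1 + c₀q^{−9/10})`:
(i) `‖Φ(s)‖ ≤ C·W` on the whole line `Re s = 1`; (ii) `‖Φ(s)‖ ≤ C𝓛¹³W` on the segment
`Re s = −c₁/𝓛`, `|Im s| ≤ D/2`; (iii) `‖Φ(s)‖ ≤ C𝓛¹³W` for `−c₁/𝓛 ≤ Re s ≤ 1`, `4 ≤ |Im s| ≤ D/2`;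
and at all these points `ζ(1+s) ≠ 0`, `L(1+s,χ) ≠ 0`. Inputs: `ζ`, `ζ⁻¹` right of `σ = 1`
(`ZetaNearOne`), Titchmarsh 3.5 and the pole of `ζ`, `‖ζ(1+s)⁻¹‖ ≤ C𝓛⁹` under (A)
(`ZetaLowerBound.norm_inv_zeta_le_pow_nine`, `zeta_ne_zero_wide`), `L(·,χ)⁻¹` next to the
exceptional zero (`Lemma84.exceptional_package`; on the left segment `|1+s−ρ̃| ≥ c₁/(2𝓛)`),
`‖𝓜₁‖ ≤ CW` (§15.u035, `Typed.Section15B.step15_u035_holds`). [cite: Zhang2022LandauSiegel, §15 (15.15) p.85] -/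
theorem phi1515_bounds (c' : ℝ) :
    ∃ c₁ : ℝ, 0 < c₁ ∧ c₁ ≤ 1 / 12 ∧ ∃ c₀ : ℝ, 0 ≤ c₀ ∧ ∃ C : ℝ, 0 ≤ C ∧
      ForAllLarge fun D _ χ => AssumptionA D χ →
        -- the exceptional zero and `L(·,χ)⁻¹` on the closed region `Re w ≥ 1 − c₁/𝓛`, `|Im w| ≤ D/2`
        (∃ ρ : ℝ, ρ < 1 ∧ 1 - ρ ≤ c₁ / (2 * ell D) ∧ χ.LFunction ρ = 0 ∧
          deriv χ.LFunction ρ ≠ 0 ∧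
          ∀ w : ℂ, 1 - c₁ / ell D ≤ w.re → |w.im| ≤ (D : ℝ) / 2 → w ≠ (ρ : ℂ) →
            χ.LFunction w ≠ 0 ∧ ‖(χ.LFunction w)⁻¹‖ ≤ C * ell D * (1 + ‖w - ρ‖⁻¹)) ∧
        -- `ζ⁻¹` on the same region (off the pole)
        (∀ w : ℂ, 1 - c₁ / ell D ≤ w.re → w.re ≤ 2 → |w.im| ≤ (D : ℝ) / 2 → w ≠ 1 →
          riemannZeta w ≠ 0 ∧ ‖(riemannZeta w)⁻¹‖ ≤ C * ell D ^ 9) ∧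
        ∀ d l : ℕ, 1 ≤ d → 1 ≤ l →
        (∀ s : ℂ, s.re = 1 →
          riemannZeta (1 + s) ≠ 0 ∧ χ.LFunction (1 + s) ≠ 0 ∧
          ‖riemannZeta (1 + s + beta1 c' D) * riemannZeta (1 + s + beta2 c' D) *
              calM1 c' χ d l (1 + s) / (riemannZeta (1 + s) * χ.LFunction (1 + s)) *
              (d : ℂ) ^ beta3 c' D‖ ≤
            C * ∏ q ∈ (d * l).primeFactors, (1 + c₀ * (q : ℝ) ^ (-(9 / 10 : ℝ)))) ∧
        (∀ s : ℂ, s.re = -(c₁ / ell D) → |s.im| ≤ (D : ℝ) / 2 →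
          riemannZeta (1 + s) ≠ 0 ∧ χ.LFunction (1 + s) ≠ 0 ∧
          ‖riemannZeta (1 + s + beta1 c' D) * riemannZeta (1 + s + beta2 c' D) *
              calM1 c' χ d l (1 + s) / (riemannZeta (1 + s) * χ.LFunction (1 + s)) *
              (d : ℂ) ^ beta3 c' D‖ ≤
            C * ell D ^ 13 * ∏ q ∈ (d * l).primeFactors, (1 + c₀ * (q : ℝ) ^ (-(9 / 10 : ℝ)))) ∧
        (∀ s : ℂ, -(c₁ / ell D) ≤ s.re → s.re ≤ 1 → 4 ≤ |s.im| → |s.im| ≤ (D : ℝ) / 2 →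
          riemannZeta (1 + s) ≠ 0 ∧ χ.LFunction (1 + s) ≠ 0 ∧
          ‖riemannZeta (1 + s + beta1 c' D) * riemannZeta (1 + s + beta2 c' D) *
              calM1 c' χ d l (1 + s) / (riemannZeta (1 + s) * χ.LFunction (1 + s)) *
              (d : ℂ) ^ beta3 c' D‖ ≤
            C * ell D ^ 13 * ∏ q ∈ (d * l).primeFactors, (1 + c₀ * (q : ℝ) ^ (-(9 / 10 : ℝ)))) := by
  -- the constants of the inputs
  obtain ⟨c, hc, hc4, CL, hCL, K, hK, D₁, hpack⟩ := Lemma84.exceptional_package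
  obtain ⟨c₀, C₃₅, h35⟩ := Typed.Section15B.step15_u035_holds c'
  obtain ⟨C₉, hC₉, h9⟩ := ZetaLowerBound.norm_inv_zeta_le_pow_nine
  have hzf := ZetaLowerBound.zeta_ne_zero_wide
  obtain ⟨M, hM0, hM⟩ := ZetaNearOne.exists_bound_riemannZeta_rect
  set c₁ : ℝ := c / 3 with hc₁
  have hc₁0 : 0 < c₁ := by rw [hc₁]; positivity
  have hc₁1 : c₁ ≤ 1 / 12 := by rw [hc₁]; linarith
  -- largeness of `𝓛`: at least `4`, `|c′|`, and `2K/c₁ + 1` (so that `1 − ρ̃ ≤ c₁/(2𝓛)`)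
  obtain ⟨D₂, hD₂⟩ := exists_nat_ell_ge (max (max 4 |c'|) (2 * K / c₁ + 1))
  -- the absolute constants
  set c₀' : ℝ := |c₀| with hc₀'
  set C₃₅' : ℝ := |C₃₅| with hC₃₅'
  set Zζ : ℝ := 16 * Real.exp 2 + M + 1 / c₁ with hZζ
  have hZζ0 : 0 ≤ Zζ := by rw [hZζ]; positivity
  set CLℓ : ℝ := 3 * CL * (1 + 2 / c₁) with hCLℓ
  have hCLℓ0 : 0 ≤ CLℓ := by rw [hCLℓ]; positivity
  set C : ℝ := max (max (16 * C₃₅') (Zζ * Zζ * C₃₅' * (C₉ + 2) * CLℓ)) (max (3 * CL) (C₉ + 2))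
    with hCdef
  have hC16 : 16 * C₃₅' ≤ C := (le_max_left _ _).trans (le_max_left _ _)
  have hCbig : Zζ * Zζ * C₃₅' * (C₉ + 2) * CLℓ ≤ C := (le_max_right _ _).trans (le_max_left _ _)
  have hC3 : 3 * CL ≤ C := (le_max_left _ _).trans (le_max_right _ _)
  have hC9 : C₉ + 2 ≤ C := (le_max_right _ _).trans (le_max_right _ _)
  have hC0 : 0 ≤ C := le_trans (by positivity) hC16
  refine ⟨c₁, hc₁0, hc₁1, c₀', abs_nonneg _, C, hC0, ?_⟩
  have hLarge : ForAllLarge fun D _ _ => D₁ ≤ D ∧ D₂ ≤ D ∧ 3 ≤ D :=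
    ForAllLarge.of_le (max (max D₁ D₂) 3) fun D _ _ hD _ _ =>
      ⟨(le_max_left _ _).trans ((le_max_left _ _).trans hD),
        (le_max_right _ _).trans ((le_max_left _ _).trans hD), (le_max_right _ _).trans hD⟩
  refine (((h35.and h9).and hzf).and hLarge).mono ?_
  intro D _ χ hq hp ⟨⟨⟨e35, e9⟩, ezf⟩, hD₁, hD₂', hD3⟩ hA
  -- the parameters at this `D`
  set ℓ : ℝ := ell D with hℓdef
  obtain ⟨hℓa, hℓb⟩ := max_le_iff.mp (hD₂ D hD₂')
  obtain ⟨hℓ4, hℓc⟩ := max_le_iff.mp hℓa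
  have hℓ0 : 0 < ℓ := by linarith
  have hℓ1 : 1 ≤ ℓ := by linarith
  have hℓinv0 : 0 < ℓ⁻¹ := inv_pos.mpr hℓ0
  have hℓinv : ℓ⁻¹ ≤ 1 / 4 := by
    rw [inv_eq_one_div]; exact one_div_le_one_div_of_le (by norm_num) hℓ4
  have hD0 : (0 : ℝ) < D := by exact_mod_cast (show 0 < D by omega)
  have hD3' : (3 : ℝ) ≤ D := by exact_mod_cast hD3
  have hℓD : (D : ℝ) = Real.exp ℓ := by rw [hℓdef, ell, Real.exp_log hD0]
  have hlogD : Real.log D = ℓ := rfl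
  have hχ1 : χ ≠ 1 := ne_one_of_isPrimitive_of_three_le hp hD3
  have hA' : ‖χ.LFunction 1‖ < (Real.log D ^ 2022)⁻¹ := by
    have h := hA; unfold AssumptionA at h; rwa [one_div] at h
  obtain ⟨ρ, hρ1, hρK, hLρ, hL'ρ, hreg⟩ := hpack D χ hD₁ hχ1 hA'
  -- `c₁/𝓛 ≤ 1/48` and the depth is inside every region used
  have hc₁ℓ : c₁ / ℓ ≤ 1 / 48 := by
    rw [div_le_div_iff₀ hℓ0 (by norm_num)]; linarith only [hc₁1, hℓ4]
  have hc₁ℓ' : c₁ / ℓ ≤ ℓ⁻¹ := by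
    rw [div_eq_mul_inv]
    calc c₁ * ℓ⁻¹ ≤ 1 * ℓ⁻¹ := by gcongr; linarith
      _ = ℓ⁻¹ := one_mul _
  have hc₁ℓ0 : 0 < c₁ / ℓ := div_pos hc₁0 hℓ0
  -- `1 − ρ̃ ≤ c₁/(2𝓛)`
  have hρc : 1 - ρ ≤ c₁ / (2 * ℓ) := by
    have hpow : ℓ ^ 2 ≤ ℓ ^ 2022 := pow_le_pow_right₀ hℓ1 (by norm_num)
    have hℓ2 : 0 < ℓ ^ 2 := pow_pos hℓ0 2
    have h2K : 2 * K ≤ c₁ * (ℓ - 1) := by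
      have := (div_le_iff₀ hc₁0).mp (show 2 * K / c₁ ≤ ℓ - 1 by linarith only [hℓb])
      linarith only [this]
    have hmain : K * (ℓ ^ 2)⁻¹ ≤ c₁ / (2 * ℓ) := by
      rw [← div_eq_mul_inv, div_le_div_iff₀ hℓ2 (by positivity)]
      nlinarith only [h2K, hℓ1, hK, hc₁0]
    calc 1 - ρ ≤ K * (Real.log D ^ 2022)⁻¹ := hρK
      _ = K * (ℓ ^ 2022)⁻¹ := by rw [hlogD]
      _ ≤ K * (ℓ ^ 2)⁻¹ := by
          gcongr
      _ ≤ c₁ / (2 * ℓ) := hmain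
  -- `log(|t| + 4) ≤ ℓ + 1` for `|t| ≤ D/2`, hence `ℓ + log(|t|+4) ≤ 3ℓ` and the region test
  have hlogt : ∀ t : ℝ, |t| ≤ (D : ℝ) / 2 → Real.log (|t| + 4) ≤ ℓ + 1 := by
    intro t ht
    have h0 : 0 < |t| + 4 := by positivity
    have h1 : |t| + 4 ≤ Real.exp 1 * D := by
      have he : (2.7 : ℝ) ≤ Real.exp 1 := by
        have := Real.exp_one_gt_d9; linarith
      nlinarith
    calc Real.log (|t| + 4) ≤ Real.log (Real.exp 1 * D) := Real.log_le_log h0 h1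
      _ = 1 + ℓ := by rw [Real.log_mul (Real.exp_pos 1).ne' hD0.ne', Real.log_exp, hlogD]
      _ = ℓ + 1 := by ring
  have hregion : ∀ w : ℂ, 1 - c₁ / ℓ ≤ w.re → |w.im| ≤ (D : ℝ) / 2 →
      1 - c / (Real.log D + Real.log (|w.im| + 4)) ≤ w.re := by
    intro w hw hwim
    have hL0 : 0 < Real.log D + Real.log (|w.im| + 4) := by
      rw [hlogD]
      have : 0 < Real.log (|w.im| + 4) := Real.log_pos (by linarith [abs_nonneg w.im])
      linarith
    have hL3 : Real.log D + Real.log (|w.im| + 4) ≤ 3 * ℓ := by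
      rw [hlogD]; linarith [hlogt w.im hwim]
    have : c₁ / ℓ ≤ c / (Real.log D + Real.log (|w.im| + 4)) := by
      rw [hc₁, div_div, div_le_div_iff₀ (by positivity) hL0]
      exact mul_le_mul_of_nonneg_left hL3 hc.le
    linarith only [this, hw]
  -- the `L⁻¹` bound in the region: `‖L(w)⁻¹‖ ≤ CL·3𝓛·(1 + ‖w − ρ̃‖⁻¹)`
  have hLinv : ∀ w : ℂ, 1 - c₁ / ℓ ≤ w.re → |w.im| ≤ (D : ℝ) / 2 → w ≠ (ρ : ℂ) →
      χ.LFunction w ≠ 0 ∧ ‖(χ.LFunction w)⁻¹‖ ≤ CL * (3 * ℓ) * (1 + ‖w - ρ‖⁻¹) := by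
    intro w hw hwim hwρ
    obtain ⟨hne, hb⟩ := hreg w (hregion w hw hwim) hwρ
    refine ⟨hne, hb.trans ?_⟩
    have hL3 : Real.log D + Real.log (|w.im| + 4) ≤ 3 * ℓ := by
      rw [hlogD]; linarith [hlogt w.im hwim]
    have h1 : 0 ≤ 1 + ‖w - ρ‖⁻¹ := by positivity
    gcongr
  -- shifts
  have hβ1re : (beta1 c' D).re = 0 := by simp [beta1]
  have hβ2re : (beta2 c' D).re = 0 := by simp [beta2]
  have hβ3re : (beta3 c' D).re = 0 := by simp [beta3]
  have hβ1im : |(beta1 c' D).im| ≤ 1 := by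
    have h := norm_betaJ_le_one c' (D := D) 1 hℓ4 hℓc
    have e : betaJ c' D 1 = beta1 c' D := by simp [betaJ]
    rw [e] at h
    exact (abs_im_le_norm _).trans h
  have hβ2im : |(beta2 c' D).im| ≤ 1 := by
    have h := norm_betaJ_le_one c' (D := D) 2 hℓ4 hℓc
    have e : betaJ c' D 2 = beta2 c' D := by simp [betaJ]
    rw [e] at h
    exact (abs_im_le_norm _).trans h
  -- `ζ(1+s+β)` in the region (distance to the pole from the real or the imaginary part)
  have hζup : ∀ (w β : ℂ), β.re = 0 → |β.im| ≤ 1 → 1 - c₁ / ℓ ≤ w.re → w.re ≤ 2 →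
      |w.im| ≤ (D : ℝ) / 2 → (w.re = 1 - c₁ / ℓ ∨ 4 ≤ |w.im|) →
      ‖riemannZeta (w + β)‖ ≤ Zζ * ℓ := by
    intro w β hβre hβim hwre hwre2 hwim hcase
    have hre' : (w + β).re = w.re := by rw [Complex.add_re, hβre, add_zero]
    have him' : (w + β).im = w.im + β.im := Complex.add_im _ _
    have hdist : c₁ / ℓ ≤ ‖w + β - 1‖ := by
      rcases hcase with h | h
      · have := abs_re_le_norm (w + β - 1)
        rw [Complex.sub_re, hre', h, Complex.one_re, show 1 - c₁ / ℓ - 1 = -(c₁ / ℓ) by ring,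
          abs_neg, abs_of_pos hc₁ℓ0] at this
        exact this
      · have h1 := abs_im_le_norm (w + β - 1)
        rw [Complex.sub_im, him', Complex.one_im, sub_zero] at h1
        have h2 : 3 ≤ |w.im + β.im| := by
          have := abs_sub_abs_le_abs_sub w.im (-β.im)
          rw [sub_neg_eq_add, abs_neg] at this
          linarith
        linarith
    have h := norm_zeta_le_region (w := w + β) (D := D) hℓ4 hℓD hM0 hM
      (by rw [hre']; linarith) (by rw [hre']; linarith)
      (by rw [him']; calc |w.im + β.im| ≤ |w.im| + |β.im| := abs_add_le _ _
            _ ≤ (D : ℝ) / 2 + 1 := by linarith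
            _ ≤ 2 * D := by linarith)
      hc₁ℓ0 hdist
    calc ‖riemannZeta (w + β)‖ ≤ 16 * Real.exp 2 * ℓ + M + (c₁ / ℓ)⁻¹ := h
      _ = 16 * Real.exp 2 * ℓ + M + ℓ / c₁ := by rw [inv_div]
      _ ≤ 16 * Real.exp 2 * ℓ + M * ℓ + (1 / c₁) * ℓ := by
          have : M ≤ M * ℓ := le_mul_of_one_le_right hM0 hℓ1
          have : ℓ / c₁ = (1 / c₁) * ℓ := by ring
          linarith
      _ = Zζ * ℓ := by rw [hZζ]; ring
  -- `ζ(1+s)⁻¹` in the region (`Re(1+s) ≥ 1 − c₁/𝓛`, `Im ≠ 0` or `Re < 1`)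
  have hζinv : ∀ w : ℂ, 1 - c₁ / ℓ ≤ w.re → w.re ≤ 2 → |w.im| ≤ (D : ℝ) / 2 → w ≠ 1 →
      riemannZeta w ≠ 0 ∧ ‖(riemannZeta w)⁻¹‖ ≤ (C₉ + 2) * ℓ ^ 9 := by
    intro w hw hw2 hwim hw1
    have hℓ9 : ℓ ≤ ℓ ^ 9 := le_self_pow₀ hℓ1 (by norm_num)
    have himD : |w.im| ≤ (D : ℝ) := by linarith
    have hne : riemannZeta w ≠ 0 := by
      rcases le_or_gt w.re 1 with h | h
      · exact ezf hA w (by linarith) (by linarith)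
      · exact riemannZeta_ne_zero_of_one_lt_re h
    refine ⟨hne, ?_⟩
    rcases le_or_gt w.re (1 + ℓ⁻¹) with h | h
    · have := e9 hA w hw1 (by linarith) h himD
      calc ‖(riemannZeta w)⁻¹‖ ≤ C₉ * ℓ ^ 9 := this
        _ ≤ (C₉ + 2) * ℓ ^ 9 := by nlinarith [pow_pos hℓ0 9]
    · have := ZetaNearOne.norm_inv_riemannZeta_le_of_re (s := w) hℓinv0 h.le
      calc ‖(riemannZeta w)⁻¹‖ ≤ 1 + 1 / ℓ⁻¹ := this
        _ = 1 + ℓ := by rw [one_div, inv_inv]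
        _ ≤ 2 * ℓ ^ 9 := by nlinarith
        _ ≤ (C₉ + 2) * ℓ ^ 9 := by nlinarith [pow_pos hℓ0 9]
  -- the `𝓜₁` bound with nonnegative constants (for the `d, l` part below)
  have hWpos : ∀ d l : ℕ, 1 ≤ ∏ q ∈ (d * l).primeFactors, (1 + c₀' * (q : ℝ) ^ (-(9 / 10 : ℝ))) := by
    intro d l
    refine le_of_eq_of_le (Finset.prod_const_one (s := (d * l).primeFactors)).symm
      (Finset.prod_le_prod (fun _ _ => zero_le_one) fun q _ => ?_)
    have : 0 ≤ c₀' * (q : ℝ) ^ (-(9 / 10 : ℝ)) := by positivity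
    linarith
  refine ⟨⟨ρ, hρ1, hρc, hLρ, hL'ρ, fun w hw hwim hwρ => ?_⟩, fun w hw hw2 hwim hw1 => ?_, ?_⟩
  · obtain ⟨hne, hb⟩ := hLinv w hw hwim hwρ
    refine ⟨hne, hb.trans ?_⟩
    have h1 : 0 ≤ 1 + ‖w - ρ‖⁻¹ := by positivity
    have : CL * (3 * ℓ) = 3 * CL * ℓ := by ring
    rw [this]
    exact mul_le_mul_of_nonneg_right (mul_le_mul_of_nonneg_right hC3 hℓ0.le) h1
  · obtain ⟨hne, hb⟩ := hζinv w hw hw2 hwim hw1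
    exact ⟨hne, hb.trans (mul_le_mul_of_nonneg_right hC9 (pow_nonneg hℓ0.le 9))⟩
  intro d l hd hl
  set W : ℝ := ∏ q ∈ (d * l).primeFactors, (1 + c₀' * (q : ℝ) ^ (-(9 / 10 : ℝ))) with hWdef
  have hW1 : 1 ≤ W := hWpos d l
  have hdβ : ‖(d : ℂ) ^ beta3 c' D‖ = 1 := norm_natCast_cpow_of_re_zero hd hβ3re
  have hW0 : 0 ≤ W := zero_le_one.trans hW1
  have hM1 : ∀ s : ℂ, 9 / 10 < s.re → ‖calM1 c' χ d l s‖ ≤ C₃₅' * W := by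
    intro s hs
    have h := e35 hA d l hd hl s hs
    refine h.trans ((le_abs_self _).trans ?_)
    rw [abs_mul, Finset.abs_prod]
    refine mul_le_mul_of_nonneg_left (Finset.prod_le_prod (fun _ _ => abs_nonneg _) fun q _ => ?_)
      (abs_nonneg _)
    have hq0 : 0 ≤ (q : ℝ) ^ (-(9 / 10 : ℝ)) := Real.rpow_nonneg (Nat.cast_nonneg q) _
    calc |1 + c₀ * (q : ℝ) ^ (-(9 / 10 : ℝ))| ≤ |(1 : ℝ)| + |c₀ * (q : ℝ) ^ (-(9 / 10 : ℝ))| :=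
          abs_add_le _ _
      _ = 1 + c₀' * (q : ℝ) ^ (-(9 / 10 : ℝ)) := by
          rw [abs_one, abs_mul, abs_of_nonneg hq0]
  have hC₃₅'0 : 0 ≤ C₃₅' := abs_nonneg _
  refine ⟨?_, ?_, ?_⟩
  · -- (i) the line `Re s = 1`
    intro s hs
    have h1s : (1 + s).re = 2 := by rw [Complex.add_re, Complex.one_re, hs]; norm_num
    have hζa : ‖riemannZeta (1 + s + beta1 c' D)‖ ≤ 2 := by
      have := ZetaNearOne.norm_riemannZeta_le_of_re (s := 1 + s + beta1 c' D) one_pos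
        (by rw [Complex.add_re, h1s, hβ1re]; norm_num)
      linarith
    have hζb : ‖riemannZeta (1 + s + beta2 c' D)‖ ≤ 2 := by
      have := ZetaNearOne.norm_riemannZeta_le_of_re (s := 1 + s + beta2 c' D) one_pos
        (by rw [Complex.add_re, h1s, hβ2re]; norm_num)
      linarith
    have hζ0 : riemannZeta (1 + s) ≠ 0 := riemannZeta_ne_zero_of_one_lt_re (by rw [h1s]; norm_num)
    have hζ0i : ‖(riemannZeta (1 + s))⁻¹‖ ≤ 2 := by
      have := ZetaNearOne.norm_inv_riemannZeta_le_of_re (s := 1 + s) one_pos (by rw [h1s]; norm_num)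
      linarith
    obtain ⟨hL0, hL0i⟩ := Lemma84.inv_LFunction_le_right χ one_pos (s := 1 + s) (by rw [h1s]; norm_num)
    have hL0i' : ‖(χ.LFunction (1 + s))⁻¹‖ ≤ 2 := by linarith
    have hm := hM1 (1 + s) (by rw [h1s]; norm_num)
    refine ⟨hζ0, hL0, ?_⟩
    calc _ ≤ 2 * 2 * (C₃₅' * W) * 2 * 2 := norm_shape_le hζa hζb hm hdβ hζ0i hL0i'
      _ = 16 * C₃₅' * W := by ring
      _ ≤ C * W := mul_le_mul_of_nonneg_right hC16 hW0
  · -- (ii) the left segment `Re s = −c₁/𝓛`, `|t| ≤ D/2`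
    intro s hs hsim
    have h1re : (1 + s).re = 1 - c₁ / ℓ := by rw [Complex.add_re, Complex.one_re, hs]; ring
    have h1im : (1 + s).im = s.im := by rw [Complex.add_im, Complex.one_im, zero_add]
    have hsim' : |(1 + s).im| ≤ (D : ℝ) / 2 := by rw [h1im]; exact hsim
    have h1re2 : (1 + s).re ≤ 2 := by rw [h1re]; linarith only [hc₁ℓ0]
    have h1re1 : (1 + s).re ≤ 1 := by rw [h1re]; linarith only [hc₁ℓ0]
    have h1re9 : 9 / 10 < (1 + s).re := by rw [h1re]; linarith only [hc₁ℓ]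
    have hw1 : 1 + s ≠ 1 := by
      intro h; have := congrArg Complex.re h
      rw [h1re, Complex.one_re] at this; linarith only [this, hc₁ℓ0]
    have hζa := hζup (1 + s) (beta1 c' D) hβ1re hβ1im h1re.ge h1re2 hsim' (Or.inl h1re)
    have hζb := hζup (1 + s) (beta2 c' D) hβ2re hβ2im h1re.ge h1re2 hsim' (Or.inl h1re)
    obtain ⟨hζ0, hζ0i⟩ := hζinv (1 + s) h1re.ge h1re2 hsim' hw1
    -- distance to the exceptional zero: `Re(1+s) = 1 − c₁/𝓛 ≤ ρ̃ − c₁/(2𝓛)`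
    have hc2 : 0 < c₁ / (2 * ℓ) := by positivity
    have hdist : c₁ / (2 * ℓ) ≤ ‖1 + s - ρ‖ := by
      have h0 := abs_re_le_norm (1 + s - ρ)
      rw [Complex.sub_re, h1re, Complex.ofReal_re] at h0
      have hhalf : c₁ / ℓ - c₁ / (2 * ℓ) = c₁ / (2 * ℓ) := by field_simp; ring
      have h3 : c₁ / (2 * ℓ) ≤ ρ - (1 - c₁ / ℓ) := by linarith only [hρc, hhalf]
      have h4 : ρ - (1 - c₁ / ℓ) ≤ |1 - c₁ / ℓ - ρ| := by
        rw [abs_sub_comm]; exact le_abs_self _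
      exact h3.trans (h4.trans h0)
    have hwρ : 1 + s ≠ (ρ : ℂ) := by
      intro h; rw [h, sub_self, norm_zero] at hdist; linarith only [hdist, hc2]
    obtain ⟨hL0, hL0i⟩ := hLinv (1 + s) h1re.ge hsim' hwρ
    have hL0i' : ‖(χ.LFunction (1 + s))⁻¹‖ ≤ CLℓ * ℓ ^ 2 := by
      have hinv : ‖1 + s - ↑ρ‖⁻¹ ≤ 2 * ℓ / c₁ := by
        have h := inv_anti₀ hc2 hdist
        rwa [inv_div] at h
      rw [hCLℓ]
      exact inv_bound_left hL0i hinv hCL hℓ1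
    have hm := hM1 (1 + s) h1re9
    refine ⟨hζ0, hL0, ?_⟩
    exact assemble_le (norm_shape_le hζa hζb hm hdβ hζ0i hL0i') hCbig hℓ0.le hW0
  · -- (iii) the horizontal segments `|t| ≥ 4`
    intro s hsre hsre1 hsim4 hsim
    have h1re : (1 + s).re = 1 + s.re := by rw [Complex.add_re, Complex.one_re]
    have h1im : (1 + s).im = s.im := by rw [Complex.add_im, Complex.one_im, zero_add]
    have hsim' : |(1 + s).im| ≤ (D : ℝ) / 2 := by rw [h1im]; exact hsim
    have hsim4' : 4 ≤ |(1 + s).im| := by rw [h1im]; exact hsim4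
    have h1rege : 1 - c₁ / ℓ ≤ (1 + s).re := by rw [h1re]; linarith only [hsre]
    have h1re1 : (1 + s).re ≤ 2 := by rw [h1re]; linarith only [hsre1]
    have h1re9 : 9 / 10 < (1 + s).re := by rw [h1re]; linarith only [hsre, hc₁ℓ]
    have hw1 : 1 + s ≠ 1 := by
      intro h; have := congrArg Complex.im h
      rw [h1im, Complex.one_im] at this
      rw [this, abs_zero] at hsim4; linarith only [hsim4]
    have hζa := hζup (1 + s) (beta1 c' D) hβ1re hβ1im h1rege h1re1 hsim' (Or.inr hsim4')
    have hζb := hζup (1 + s) (beta2 c' D) hβ2re hβ2im h1rege h1re1 hsim' (Or.inr hsim4')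
    obtain ⟨hζ0, hζ0i⟩ := hζinv (1 + s) h1rege h1re1 hsim' hw1
    have hdist : 4 ≤ ‖1 + s - ρ‖ := by
      have h0 := abs_im_le_norm (1 + s - ρ)
      rw [Complex.sub_im, h1im, Complex.ofReal_im, sub_zero] at h0
      exact hsim4.trans h0
    have hwρ : 1 + s ≠ (ρ : ℂ) := by
      intro h; rw [h, sub_self, norm_zero] at hdist; linarith only [hdist]
    obtain ⟨hL0, hL0i⟩ := hLinv (1 + s) h1rege hsim' hwρ
    have hL0i' : ‖(χ.LFunction (1 + s))⁻¹‖ ≤ CLℓ * ℓ ^ 2 := by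
      have hinv : ‖1 + s - ↑ρ‖⁻¹ ≤ 1 / 4 := by
        rw [one_div]; exact inv_anti₀ (by norm_num) hdist
      rw [hCLℓ]
      exact inv_bound_horiz hL0i hinv hCL hℓ1 hc₁0 hc₁1
    have hm := hM1 (1 + s) h1re9
    refine ⟨hζ0, hL0, ?_⟩
    exact assemble_le (norm_shape_le hζa hζb hm hdβ hζ0i hL0i') hCbig hℓ0.le hW0


/-! ## Holomorphy right of the line `Re s = 0` and continuity on the line `Re s = 1` -/

/-- **`Φ` is holomorphic on `Re s > 0`** (there `Re(1+s) > 1`: `ζ(1+s) ≠ 0`, `L(1+s,χ) ≠ 0`,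
`1 + s + β_j ≠ 1`, and `𝓜₁(d,l;·)` is holomorphic on `σ > 9/10` by §15.u034), under (A), `D` large,
`d, l ≥ 1`. [cite: Zhang2022LandauSiegel, §15 (15.15)–(15.16) p.85] -/
theorem differentiableOn_phi1515_right (c' : ℝ) :
    ForAllLarge fun D _ χ => AssumptionA D χ → ∀ d l : ℕ, 1 ≤ d → 1 ≤ l →
      DifferentiableOn ℂ (fun s : ℂ =>
        riemannZeta (1 + s + beta1 c' D) * riemannZeta (1 + s + beta2 c' D) *
          calM1 c' χ d l (1 + s) / (riemannZeta (1 + s) * χ.LFunction (1 + s)) *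
          (d : ℂ) ^ beta3 c' D) {s : ℂ | 0 < s.re} := by
  have h34 := Typed.Section15B.step15_u034an_holds c'
  have hLarge : ForAllLarge fun D _ _ => 3 ≤ D := ForAllLarge.of_le 3 fun D _ _ hD _ _ => hD
  refine (h34.and hLarge).mono ?_
  intro D _ χ _ hp ⟨e34, hD3⟩ hA d l hd hl
  have hχ1 : χ ≠ 1 := ne_one_of_isPrimitive_of_three_le hp hD3
  obtain ⟨-, hMd⟩ := e34 hA d l hd hl
  have hβ1re : (beta1 c' D).re = 0 := by simp [beta1]
  have hβ2re : (beta2 c' D).re = 0 := by simp [beta2]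
  -- the pieces
  have hlin : ∀ β : ℂ, Differentiable ℂ (fun s : ℂ => 1 + s + β) := fun β =>
    ((differentiable_const (1 : ℂ)).add differentiable_id).add (differentiable_const β)
  have hζ : ∀ β : ℂ, β.re = 0 →
      DifferentiableOn ℂ (fun s : ℂ => riemannZeta (1 + s + β)) {s : ℂ | 0 < s.re} := by
    intro β hβ s hs
    have hs' : 0 < s.re := hs
    have hne : 1 + s + β ≠ 1 := by
      intro h
      have := congrArg Complex.re h
      simp only [Complex.add_re, Complex.one_re, hβ, add_zero] at this
      linarith
    exact ((differentiableAt_riemannZeta hne).comp s (hlin β s)).differentiableWithinAt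
  have hζ0 : DifferentiableOn ℂ (fun s : ℂ => riemannZeta (1 + s)) {s : ℂ | 0 < s.re} := by
    have h := hζ 0 (by simp)
    refine h.congr fun s _ => ?_
    simp only [add_zero]
  have hL : DifferentiableOn ℂ (fun s : ℂ => χ.LFunction (1 + s)) {s : ℂ | 0 < s.re} :=
    fun s _ => (((DirichletCharacter.differentiable_LFunction hχ1) (1 + s)).comp s
      (((differentiable_const (1 : ℂ)).add differentiable_id) s)).differentiableWithinAt
  have hM : DifferentiableOn ℂ (fun s : ℂ => calM1 c' χ d l (1 + s)) {s : ℂ | 0 < s.re} := by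
    refine hMd.comp (((differentiable_const (1 : ℂ)).add differentiable_id).differentiableOn) ?_
    intro s hs
    have hs' : 0 < s.re := hs
    show 9 / 10 < (1 + s).re
    rw [Complex.add_re, Complex.one_re]; linarith
  have hden : ∀ s ∈ {s : ℂ | 0 < s.re}, riemannZeta (1 + s) * χ.LFunction (1 + s) ≠ 0 := by
    intro s hs
    have hs' : 0 < s.re := hs
    have hre : 1 < (1 + s).re := by rw [Complex.add_re, Complex.one_re]; linarith
    exact mul_ne_zero (riemannZeta_ne_zero_of_one_lt_re hre)
      (DirichletCharacter.LFunction_ne_zero_of_one_le_re χ (Or.inl hχ1) hre.le)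
  exact ((((hζ _ hβ1re).mul (hζ _ hβ2re)).mul hM).div (hζ0.mul hL) hden).mul
    (differentiableOn_const _)

/-- **`t ↦ Φ(1+it)` is continuous** (the integrability input `hint` of
`GaussKernelContour.norm_lineIntegral_sub_residues_le` at `σ₀ = 1`, via
`GaussKernelContour.integrable_integrand_line`), under (A), `D` large, `d, l ≥ 1`.
[cite: Zhang2022LandauSiegel, §15 (15.15) p.85] -/
theorem continuous_phi1515_line (c' : ℝ) :
    ForAllLarge fun D _ χ => AssumptionA D χ → ∀ d l : ℕ, 1 ≤ d → 1 ≤ l →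
      Continuous fun t : ℝ =>
        riemannZeta (1 + (((1 : ℝ) : ℂ) + t * I) + beta1 c' D) *
            riemannZeta (1 + (((1 : ℝ) : ℂ) + t * I) + beta2 c' D) *
          calM1 c' χ d l (1 + (((1 : ℝ) : ℂ) + t * I)) /
            (riemannZeta (1 + (((1 : ℝ) : ℂ) + t * I)) * χ.LFunction (1 + (((1 : ℝ) : ℂ) + t * I))) *
          (d : ℂ) ^ beta3 c' D := by
  refine (differentiableOn_phi1515_right c').mono ?_
  intro D _ χ _ _ h hA d l hd hl
  have hF := (h hA d l hd hl).continuousOn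
  have hline : Continuous fun t : ℝ => (((1 : ℝ) : ℂ) + t * I) :=
    continuous_const.add (Complex.continuous_ofReal.mul continuous_const)
  have hmem : ∀ t : ℝ, (((1 : ℝ) : ℂ) + t * I) ∈ {s : ℂ | 0 < s.re} := by
    intro t
    show 0 < (((1 : ℝ) : ℂ) + t * I).re
    simp
  exact hF.comp_continuous hline hmem

end Literature.NumberTheory.LFunctions.Zhang2022.Eq1515

end
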